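import Mathlib
import Summits.Ventures.PercRepro2.V2SP
import Summits.Ventures.PercRepro2.HallOffFrame
import Summits.Ventures.PercRepro2.HallOffAxis
import Summits.Ventures.PercRepro2.Tail2DOffAxis31
import Summits.Ventures.PercRepro2.Tail2DOffAxis41
import Summits.Ventures.PercRepro2.Tail2DOffAxis51
import Summits.Ventures.PercRepro2.Tail2DRowOne
import Summits.Ventures.PercRepro2.Tail2DStepRowZero
import Summits.Ventures.PercRepro2.Tail2DStepCert
import Summits.Ventures.PercRepro2.Tail2DStepFour
import Summits.Ventures.PercRepro2.Tail2DStepFive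
import Summits.Ventures.PercRepro2.Tail2DUnitStep
import Summits.Ventures.PercRepro2.Tail2DUnitStepRowZero
import Summits.Ventures.PercRepro2.Tail2DQStepCert
import Summits.Ventures.PercRepro2.Tail2DQStep13
import Summits.Ventures.PercRepro2.Tail2DQStepCert14
import Summits.Ventures.PercRepro2.Tail2DQStepCert15
import Summits.Ventures.PercRepro2.Tail2DQStepCert24

/-!
# QSTEP(1,4), QSTEP(1,5) and QSTEP(2,4) on every series–parallel network
(seat mine-b, cell pub-perc-repro2; MINE-B.md §39.19)

`4·#{r = 1 ∧ b ≥ 4} ≤ 2·#{r = 2 ∧ b ≥ 3}`, `5·#{r = 1 ∧ b ≥ 5} ≤ 2·#{r = 2 ∧ b ≥ 4}`, `4·#{r = 2 ∧ b ≥ 4} ≤ 3·#{r = 3 ∧ b ≥ 3}` —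
the binomial-ratio forms of the STEP members (1,4), (1,5), (2,4), tight on the bundles of five, six and six edges.
Induction over the grammar as for QSTEP(1,3) (`Tail2DQStep13.lean`): the atoms have flows `≤ 1`; the series steps
are `qstep_ser` with the anti-diagonal comparisons `t41_le_t32`, `t42_le_t33`, `t51_le_t42`, `t52_le_t43` after the
colour swap; the parallel steps are the kernel-decided certificates `qstep14_par`, `qstep15_par`, `qstep24_par`
(the closed set F₂ of §39.17: QSTEP(1,4) needs the row `i = 0`, QSTEP(1,3) and itself on the factors; QSTEP(1,5)
and QSTEP(2,4) need QSTEP(1,4) as well, hence are proved after it).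
-/

namespace Summit.Ventures.PercRepro2.Tail2D

open V2Closure

/-- the count of `psi 2 3` (offset one: the count of `psi 2 4` = STEP(2,4) = `step_four`) -/
lemma sum_psi_two_three_nonneg (s : V2Closure.SP) : 0 ≤ ∑ x, psi 2 3 (s.rLab x) (s.bLab x) := by
  rw [sum_psi_offset_one s 2]
  exact (step_iff' s 2 4).1 (step_four s).2

/-- the atoms: no configuration with `r = i ≥ 1` and `b ≥ j ≥ 2` -/
lemma atom_qstep (s : V2Closure.SP) (hs : s = .free ∨ s = .pin ∨ s = .absent) (i j : ℕ) (hj : 2 ≤ j) :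
    j * (Finset.univ.filter (fun y : s.Conf => s.rLab y = i ∧ j ≤ s.bLab y)).card
      ≤ (i + 1) * (Finset.univ.filter (fun y : s.Conf => s.rLab y = i + 1 ∧ j - 1 ≤ s.bLab y)).card := by
  rw [Finset.card_eq_zero.2 (Finset.filter_eq_empty_iff.2 (fun y _ => by
    have := atom_bLab_le_one s hs y; omega))]
  simp

/-- **QSTEP(1,4) on every pattern of the grammar**: `4·#{r = 1 ∧ b ≥ 4} ≤ 2·#{r = 2 ∧ b ≥ 3}` -/
theorem qstep14 : ∀ s : V2Closure.SP,
    4 * (Finset.univ.filter (fun y : s.Conf => s.rLab y = 1 ∧ 4 ≤ s.bLab y)).card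
      ≤ (1 + 1) * (Finset.univ.filter (fun y : s.Conf => s.rLab y = 1 + 1 ∧ 4 - 1 ≤ s.bLab y)).card
  | .free => atom_qstep .free (Or.inl rfl) 1 4 (by norm_num)
  | .pin => atom_qstep .pin (Or.inr (Or.inl rfl)) 1 4 (by norm_num)
  | .absent => atom_qstep .absent (Or.inr (Or.inr rfl)) 1 4 (by norm_num)
  | .ser s t => by
    refine qstep_ser s t 1 4 (qstep14 s) (qstep14 t) ?_ ?_
    · rw [tail_symm t 1 4, tail_symm t (1 + 1) (4 - 1)]
      exact t41_le_t32 t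
    · rw [tail_symm s (1 + 1) 4]
      exact t42_le_t33 s
  | .par s t => by
    refine (qstep_iff' (.par s t) 1 4).2 (qstep14_par s t ?_ ?_ ?_ ?_ ?_ ?_ ?_ ?_ ?_ ?_ ?_ ?_ ?_ ?_ ?_ ?_)
    · exact SP.sum_psi_zero_nonneg s 3 (by norm_num)
    · exact SP.sum_psi_zero_nonneg s 4 (by norm_num)
    · exact sum_psi_one_two_nonneg s
    · exact sum_qpsi_zero_nonneg s 2
    · exact sum_qpsi_zero_nonneg s 3
    · exact sum_qpsi_zero_nonneg s 4
    · exact (qstep_iff' s 1 3).1 (qstep13 s)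
    · exact (qstep_iff' s 1 4).1 (qstep14 s)
    · exact SP.sum_psi_zero_nonneg t 3 (by norm_num)
    · exact SP.sum_psi_zero_nonneg t 4 (by norm_num)
    · exact sum_psi_one_two_nonneg t
    · exact sum_qpsi_zero_nonneg t 2
    · exact sum_qpsi_zero_nonneg t 3
    · exact sum_qpsi_zero_nonneg t 4
    · exact (qstep_iff' t 1 3).1 (qstep13 t)
    · exact (qstep_iff' t 1 4).1 (qstep14 t)

/-- **QSTEP(1,5) on every pattern of the grammar**: `5·#{r = 1 ∧ b ≥ 5} ≤ 2·#{r = 2 ∧ b ≥ 4}` -/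
theorem qstep15 : ∀ s : V2Closure.SP,
    5 * (Finset.univ.filter (fun y : s.Conf => s.rLab y = 1 ∧ 5 ≤ s.bLab y)).card
      ≤ (1 + 1) * (Finset.univ.filter (fun y : s.Conf => s.rLab y = 1 + 1 ∧ 5 - 1 ≤ s.bLab y)).card
  | .free => atom_qstep .free (Or.inl rfl) 1 5 (by norm_num)
  | .pin => atom_qstep .pin (Or.inr (Or.inl rfl)) 1 5 (by norm_num)
  | .absent => atom_qstep .absent (Or.inr (Or.inr rfl)) 1 5 (by norm_num)
  | .ser s t => by
    refine qstep_ser s t 1 5 (qstep15 s) (qstep15 t) ?_ ?_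
    · rw [tail_symm t 1 5, tail_symm t (1 + 1) (5 - 1)]
      exact t51_le_t42 t
    · rw [tail_symm s (1 + 1) 5, tail_symm s (1 + 1 + 1) (5 - 1)]
      exact t52_le_t43 s
  | .par s t => by
    refine (qstep_iff' (.par s t) 1 5).2 (qstep15_par s t ?_ ?_ ?_ ?_ ?_ ?_ ?_ ?_ ?_ ?_ ?_ ?_ ?_ ?_ ?_ ?_ ?_ ?_ ?_ ?_)
    · exact SP.sum_psi_zero_nonneg s 3 (by norm_num)
    · exact SP.sum_psi_zero_nonneg s 4 (by norm_num)
    · exact SP.sum_psi_zero_nonneg s 5 (by norm_num)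
    · exact sum_qpsi_zero_nonneg s 2
    · exact sum_qpsi_zero_nonneg s 3
    · exact sum_qpsi_zero_nonneg s 4
    · exact sum_qpsi_zero_nonneg s 5
    · exact (qstep_iff' s 1 3).1 (qstep13 s)
    · exact (qstep_iff' s 1 4).1 (qstep14 s)
    · exact (qstep_iff' s 1 5).1 (qstep15 s)
    · exact SP.sum_psi_zero_nonneg t 3 (by norm_num)
    · exact SP.sum_psi_zero_nonneg t 4 (by norm_num)
    · exact SP.sum_psi_zero_nonneg t 5 (by norm_num)
    · exact sum_qpsi_zero_nonneg t 2
    · exact sum_qpsi_zero_nonneg t 3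
    · exact sum_qpsi_zero_nonneg t 4
    · exact sum_qpsi_zero_nonneg t 5
    · exact (qstep_iff' t 1 3).1 (qstep13 t)
    · exact (qstep_iff' t 1 4).1 (qstep14 t)
    · exact (qstep_iff' t 1 5).1 (qstep15 t)

/-- **QSTEP(2,4) on every pattern of the grammar**: `4·#{r = 2 ∧ b ≥ 4} ≤ 3·#{r = 3 ∧ b ≥ 3}` -/
theorem qstep24 : ∀ s : V2Closure.SP,
    4 * (Finset.univ.filter (fun y : s.Conf => s.rLab y = 2 ∧ 4 ≤ s.bLab y)).card
      ≤ (2 + 1) * (Finset.univ.filter (fun y : s.Conf => s.rLab y = 2 + 1 ∧ 4 - 1 ≤ s.bLab y)).card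
  | .free => atom_qstep .free (Or.inl rfl) 2 4 (by norm_num)
  | .pin => atom_qstep .pin (Or.inr (Or.inl rfl)) 2 4 (by norm_num)
  | .absent => atom_qstep .absent (Or.inr (Or.inr rfl)) 2 4 (by norm_num)
  | .ser s t => by
    refine qstep_ser s t 2 4 (qstep24 s) (qstep24 t) ?_ ?_
    · rw [tail_symm t 2 4]
      exact t42_le_t33 t
    · exact le_of_eq (tail_symm s (2 + 1) 4)
  | .par s t => by
    refine (qstep_iff' (.par s t) 2 4).2 (qstep24_par s t ?_ ?_ ?_ ?_ ?_ ?_ ?_ ?_ ?_ ?_ ?_ ?_ ?_ ?_ ?_ ?_ ?_ ?_ ?_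
      ?_ ?_ ?_ ?_ ?_ ?_ ?_ ?_ ?_ ?_ ?_ ?_ ?_ ?_ ?_ ?_ ?_ ?_ ?_)
    · exact SP.hallFn_phi_axis_count s 1 (by norm_num)
    · exact SP.hallFn_phi_axis_count s 3 (by norm_num)
    · exact SP.sum_phi_row_nonneg s 3 (by norm_num)
    · exact SP.hallFn_phi_axis_count s 4 (by norm_num)
    · exact SP.sum_phi_row_nonneg s 4 (by norm_num)
    · exact SP.sum_psi_zero_nonneg s 1 (by norm_num)
    · exact SP.sum_psi_zero_nonneg s 2 (by norm_num)
    · exact SP.sum_psi_zero_nonneg s 3 (by norm_num)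
    · exact SP.sum_psi_zero_nonneg s 4 (by norm_num)
    · exact SP.sum_psi_zero_nonneg s 5 (by norm_num)
    · exact sum_psi_one_two_nonneg s
    · exact (step_iff' s 1 4).1 (step_four s).1
    · exact sum_psi_two_three_nonneg s
    · exact sum_qpsi_zero_nonneg s 2
    · exact sum_qpsi_zero_nonneg s 3
    · exact sum_qpsi_zero_nonneg s 4
    · exact (qstep_iff' s 1 3).1 (qstep13 s)
    · exact (qstep_iff' s 1 4).1 (qstep14 s)
    · exact (qstep_iff' s 2 4).1 (qstep24 s)
    · exact SP.hallFn_phi_axis_count t 1 (by norm_num)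
    · exact SP.hallFn_phi_axis_count t 3 (by norm_num)
    · exact SP.sum_phi_row_nonneg t 3 (by norm_num)
    · exact SP.hallFn_phi_axis_count t 4 (by norm_num)
    · exact SP.sum_phi_row_nonneg t 4 (by norm_num)
    · exact SP.sum_psi_zero_nonneg t 1 (by norm_num)
    · exact SP.sum_psi_zero_nonneg t 2 (by norm_num)
    · exact SP.sum_psi_zero_nonneg t 3 (by norm_num)
    · exact SP.sum_psi_zero_nonneg t 4 (by norm_num)
    · exact SP.sum_psi_zero_nonneg t 5 (by norm_num)
    · exact sum_psi_one_two_nonneg t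
    · exact (step_iff' t 1 4).1 (step_four t).1
    · exact sum_psi_two_three_nonneg t
    · exact sum_qpsi_zero_nonneg t 2
    · exact sum_qpsi_zero_nonneg t 3
    · exact sum_qpsi_zero_nonneg t 4
    · exact (qstep_iff' t 1 3).1 (qstep13 t)
    · exact (qstep_iff' t 1 4).1 (qstep14 t)
    · exact (qstep_iff' t 2 4).1 (qstep24 t)

/-- QSTEP(1,4) with the numerals evaluated: `4·#{r = 1 ∧ b ≥ 4} ≤ 2·#{r = 2 ∧ b ≥ 3}` -/
theorem qstep14' (s : V2Closure.SP) :
    4 * (Finset.univ.filter (fun y : s.Conf => s.rLab y = 1 ∧ 4 ≤ s.bLab y)).card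
      ≤ 2 * (Finset.univ.filter (fun y : s.Conf => s.rLab y = 2 ∧ 3 ≤ s.bLab y)).card := qstep14 s

/-- QSTEP(1,5) with the numerals evaluated: `5·#{r = 1 ∧ b ≥ 5} ≤ 2·#{r = 2 ∧ b ≥ 4}` -/
theorem qstep15' (s : V2Closure.SP) :
    5 * (Finset.univ.filter (fun y : s.Conf => s.rLab y = 1 ∧ 5 ≤ s.bLab y)).card
      ≤ 2 * (Finset.univ.filter (fun y : s.Conf => s.rLab y = 2 ∧ 4 ≤ s.bLab y)).card := qstep15 s

/-- QSTEP(2,4) with the numerals evaluated: `4·#{r = 2 ∧ b ≥ 4} ≤ 3·#{r = 3 ∧ b ≥ 3}` -/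
theorem qstep24' (s : V2Closure.SP) :
    4 * (Finset.univ.filter (fun y : s.Conf => s.rLab y = 2 ∧ 4 ≤ s.bLab y)).card
      ≤ 3 * (Finset.univ.filter (fun y : s.Conf => s.rLab y = 3 ∧ 3 ≤ s.bLab y)).card := qstep24 s

end Summit.Ventures.PercRepro2.Tail2D
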